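import Summits.HodgeConjecture.CorCM.MumfordTateRankTypeIVTimesCMCurveRigid
import Summits.HodgeConjecture.CorCM.MumfordTateRankThreeSquareRoots
import Literature.AlgebraicGeometry.Motives.HodgeLieRigidTimesRankOneFamily
import HarnessLib

/-!
# `Lie Hg(H¹(A × E' × E'')) = Lie Hg(H¹(A × E')) ⊕ ℚ` and `Θ`-rigidity for a `Θ`-rigid `A` with imaginary quadratic `End⁰A = k` and two CM elliptic
# curves whose fields `k', k''` and `k` are pairwise distinct — the tower step behind `T × E' × E'' = 12` (Moonen–Zarhin 1999 §3 (3.1), (3.6), (3.8))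

COR-CM (cell `pub-hodgecm2`, seat `b27` gen 50, count-neutral Mumford–Tate-rank ladder; theorems only, no definition, no named fact;
UNCONDITIONAL — nothing here uses or asserts HC_CM).  Notation `t(X) = dim MT(H¹X) = dim Lie Hg(H¹X) + 1`.

The tower step of `Motives/HodgeLieRigidTimesRankOneFamily` §2 (trace test ⟹ corner, splitting AND rigidity) applied to
`H₁ = H¹(A × E')` — `Θ`-rigid by `CorCM/MumfordTateRankTypeIVTimesCMCurveRigid`, with centre of `Lie Hg` inside `End_Hdg` spanned by the two
trace-orthogonal Hodge endomorphisms `φ̃ = ι_A φ^* π_A`, `χ̃' = ι_{E'} χ'^* π_{E'}` — and `H₂ = H¹(E'')`.  The trace test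
`tr(Θ_{E''} χ''^*) ≠ tr((χ''^*)²)·(ν₀ tr(Θ₁ φ̃) + ν₁ tr(Θ₁ χ̃'))` reads `±√d'' ≠ −2d''(ν₀ (n₊ − n₋) √d ± ν₁ √d')`
(`φ ∘ φ = −d`, `χ' ∘ χ' = −d'`, `χ'' ∘ χ'' = −d''`), which holds because three square roots with pairwise non-square ratios are
`ℚ`-linearly independent (`CorCM/MumfordTateRankThreeSquareRoots`).

* §1 **`finrank_hodgeLie_eq_and_rigid_prod_cmCurve_prod_cmCurve`** — `dim Lie Hg(H¹((A × E') × E'')) = dim Lie Hg(H¹(A × E')) + 1` AND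
  `H¹((A × E') × E'')` is `Θ`-rigid (`A` `Θ`-rigid, `dim_ℚ End⁰A = 2`, `φ ∘ φ = −d`; `d, d', d''` pairwise of non-square ratio).
* The rank readings — `t(X) = t(A) + 2` for `X ∼ A × (E' × E'')` (no ring homomorphisms `End⁰E' → End⁰A`, `End⁰E'' → End⁰A`, `End⁰E'' → End⁰E'`),
  Ribet type `g² + 3`, the fivefold cell `T × E' × E'' = 12`, the monotonicity `t(A) + 2 ≤ t((A × E' × E'') × Y)` — are in
  `CorCM/MumfordTateRankTypeIVTimesTwoCMCurvesCells`.

## References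
* [MoonenZarhin1999LowDim] B. Moonen, Yu. G. Zarhin, *Hodge classes on abelian varieties of low dimension*, Math. Ann. 315 (1999), §3 (3.1),
  Lemma (3.6), Prop. (3.8), Thm. 0.1 (4) [corpus: paper:arxiv-math_9901113 pp. 1, 6–7]. [cite: MoonenZarhin1999LowDim, §3 (3.1), (3.6) and (3.8)]
* [Deligne1982HodgeCycles] P. Deligne, LNM 900 (1982), I §3.1, Prop. 3.4 and Prop. 3.6. [cite: Deligne1982HodgeCycles, I §3 Prop. 3.6]
* [Ribet1983] K. A. Ribet, Amer. J. Math. 105 (1983), Thm. 3. [cite: Ribet1983, Thm. 3]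
-/

noncomputable section

open scoped TensorProduct BigOperators
open CategoryTheory CategoryTheory.Limits Module

namespace Summit.HodgeConjecture.CorCM

open Literature.AlgebraicGeometry.Motives
open Literature.AlgebraicGeometry.Motives.AbelianVariety
open Literature.AlgebraicGeometry.Motives.HodgeStructure
open Literature.AlgebraicGeometry.HodgeTheory
open Literature.AlgebraicGeometry.ComplexMultiplication
open Literature.AlgebraicGeometry.Milne1999 (IsOfCMType)

variable [HodgeTensorFacts.{0, 0}] {X A C' C'' : AbelianVariety ℂ} {n n₁ : ℕ}

/-! ## §1 The tower step: `H¹((A × E') × E'')` splits off `Lie Hg(H¹E'')` and stays `Θ`-rigid -/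

/-- **`dim Lie Hg(H¹((A × E') × E'')) = dim Lie Hg(H¹(A × E')) + 1` and `H¹((A × E') × E'')` is `Θ`-rigid**, for `A` with `0 < dim A`,
`dim_ℚ End⁰A = 2`, `φ ∘ φ = −d` and `Θ`-rigid `H¹(A)`, and elliptic curves `E'`, `E''` with `χ' ∘ χ' = −d'`, `χ'' ∘ χ'' = −d''`, the three ratios
`d/d'`, `d/d''`, `d'/d''` being non-squares.  The corner-free trace test (`corner_mem_and_finrank_eq_and_rigid_of_trace_ne_sum`) on the bicone
`H¹((A × E') × E'') = fst^* H¹(A × E') ⊕ snd^* H¹(E'')`: `H¹(A × E')` is `Θ`-rigid (`hodgeLie_rigid_prod_cmCurve_of_rigid_of_quadraticEnd`), its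
centre inside `End_Hdg` lies in `ℚφ̃ ⊕ ℚχ̃'` (blocks: `ℚφ^*` by `quadraticEnd_skewCentre_data`, `ℚχ'^*` by `RankTwoCM`), `tr(φ̃ χ̃') = 0`,
`tr(φ̃²) = −2d·dim A`, `tr(χ̃'²) = −2d'`; `Lie Hg(H¹E'') ⊆ ℚχ''^*`; and `tr(Θ_{E''} χ''^*) = tr((χ''^*)²)(ν₀ tr(Θ₁ φ̃) + ν₁ tr(Θ₁ χ̃'))` would be a
rational relation `±√d'' + 2d''ν₀(n₊ − n₋)√d ± 2d''ν₁√d' = 0` (`CorCM/MumfordTateRankThreeSquareRoots`). [cite: MoonenZarhin1999LowDim, §3 (3.1), (3.6) and (3.8)]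
[cite: Deligne1982HodgeCycles, I §3 Prop. 3.6] -/
theorem finrank_hodgeLie_eq_and_rigid_prod_cmCurve_prod_cmCurve (hA : IsSmoothProjective n₁ A.X) {m₁ : ℕ}
    (hP₁ : IsSmoothProjective m₁ (A.prod C').X) {m : ℕ} (hP : IsSmoothProjective m ((A.prod C').prod C'').X)
    (hA0 : 0 < A.dim) (hA2 : Module.finrank ℚ A.endAlgebra = 2) (φ : A ⟶ A) {d : ℕ} (hd : 0 < d) (hφ : φ ≫ φ = -(d • 𝟙 A))
    (hrigA : haveI := BettiUniverse.finite hA 1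
      ∀ 𝔞 : Submodule ℚ (Module.End ℚ (bettiCohomology A.X 1)),
        𝔞 ≤ (BettiUniverse.hodge exists_isReal_hodgeModel_holds hA 1).hodgeLie →
        (∀ B ∈ 𝔞, ∀ B' ∈ 𝔞, B * B' - B' * B ∈ 𝔞) →
        (∃ Θ ∈ Submodule.span ℂ ((fun B : Module.End ℚ (bettiCohomology A.X 1) => B.baseChange ℂ) ''
            (𝔞 : Set (Module.End ℚ (bettiCohomology A.X 1)))),
          ∀ p, ∀ x ∈ (BettiUniverse.hodge exists_isReal_hodgeModel_holds hA 1).piece p (((1 : ℕ) : ℤ) - p),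
            Θ x = ((2 * p - ((1 : ℕ) : ℤ) : ℤ) : ℂ) • x) →
        (BettiUniverse.hodge exists_isReal_hodgeModel_holds hA 1).hodgeLie ≤ 𝔞)
    (hC'1 : C'.dim = 1) (χ' : C' ⟶ C') {d' : ℕ} (hd' : 0 < d') (hχ' : χ' ≫ χ' = -(d' • 𝟙 C'))
    (hC''1 : C''.dim = 1) (χ'' : C'' ⟶ C'') {d'' : ℕ} (hd'' : 0 < d'') (hχ'' : χ'' ≫ χ'' = -(d'' • 𝟙 C''))
    (hfree' : ∀ q : ℚ, (d : ℚ) ≠ q ^ 2 * d') (hfree'' : ∀ q : ℚ, (d : ℚ) ≠ q ^ 2 * d'') (hfree''' : ∀ q : ℚ, (d' : ℚ) ≠ q ^ 2 * d'') :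
    haveI := BettiUniverse.finite hP 1
    haveI := BettiUniverse.finite hP₁ 1
    Module.finrank ℚ (BettiUniverse.hodge exists_isReal_hodgeModel_holds hP 1).hodgeLie =
        Module.finrank ℚ (BettiUniverse.hodge exists_isReal_hodgeModel_holds hP₁ 1).hodgeLie + 1 ∧
      ∀ 𝔞 : Submodule ℚ (Module.End ℚ (bettiCohomology ((A.prod C').prod C'').X 1)),
        𝔞 ≤ (BettiUniverse.hodge exists_isReal_hodgeModel_holds hP 1).hodgeLie →
        (∀ B ∈ 𝔞, ∀ B' ∈ 𝔞, B * B' - B' * B ∈ 𝔞) →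
        (∃ Θ ∈ Submodule.span ℂ ((fun B : Module.End ℚ (bettiCohomology ((A.prod C').prod C'').X 1) => B.baseChange ℂ) ''
            (𝔞 : Set (Module.End ℚ (bettiCohomology ((A.prod C').prod C'').X 1)))),
          ∀ p, ∀ x ∈ (BettiUniverse.hodge exists_isReal_hodgeModel_holds hP 1).piece p (((1 : ℕ) : ℤ) - p),
            Θ x = ((2 * p - ((1 : ℕ) : ℤ) : ℤ) : ℂ) • x) →
        (BettiUniverse.hodge exists_isReal_hodgeModel_holds hP 1).hodgeLie ≤ 𝔞 := by
  classical
  have hnA : A.dim = n₁ := schemeDim_eq_holds hA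
  subst hnA
  have hC' : IsSmoothProjective C'.dim C'.X := AbelianVariety.isSmoothProjective_holds
  have hC'' : IsSmoothProjective C''.dim C''.X := AbelianVariety.isSmoothProjective_holds
  haveI := BettiUniverse.finite hP 1
  haveI := BettiUniverse.finite hP₁ 1
  haveI := BettiUniverse.finite hA 1
  haveI := BettiUniverse.finite hC' 1
  haveI := BettiUniverse.finite hC'' 1
  -- the outer bicone `H¹(P₁ × E'') = fst^* H¹P₁ ⊕ snd^* H¹E''`, `P₁ = A × E'`
  let ι₁ := BettiUniverse.pullHodgeHom exists_isReal_hodgeModel_holds hodgePQ_independent_of_hodgeModel_holds hP hP₁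
    (fst (A.prod C') C'').hom.hom.hom 1
  let π₁ := BettiUniverse.pullHodgeHom exists_isReal_hodgeModel_holds hodgePQ_independent_of_hodgeModel_holds hP₁ hP
    (prodLift (𝟙 (A.prod C')) (0 : A.prod C' ⟶ C'')).hom.hom.hom 1
  let ι₂ := BettiUniverse.pullHodgeHom exists_isReal_hodgeModel_holds hodgePQ_independent_of_hodgeModel_holds hP hC''
    (snd (A.prod C') C'').hom.hom.hom 1
  let π₂ := BettiUniverse.pullHodgeHom exists_isReal_hodgeModel_holds hodgePQ_independent_of_hodgeModel_holds hC'' hP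
    (prodLift (0 : C'' ⟶ A.prod C') (𝟙 C'')).hom.hom.hom 1
  have hsumP : fst (A.prod C') C'' ≫ prodLift (𝟙 (A.prod C')) (0 : A.prod C' ⟶ C'') +
      snd (A.prod C') C'' ≫ prodLift (0 : C'' ⟶ A.prod C') (𝟙 C'') = 𝟙 _ := by
    refine prod_hom_ext ?_ ?_
    · rw [Preadditive.add_comp, Category.assoc, Category.assoc, prodLift_fst, prodLift_fst, Category.comp_id,
        comp_zero, add_zero, Category.id_comp]
    · rw [Preadditive.add_comp, Category.assoc, Category.assoc, prodLift_snd, prodLift_snd, Category.comp_id,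
        comp_zero, zero_add, Category.id_comp]
  have hπι₁ : ∀ v, π₁.toLinearMap (ι₁.toLinearMap v) = v := fun v => pull_pull_eq_self_of_comp_eq_id (prodLift_fst _ _) v
  have hπι₂ : ∀ v, π₂.toLinearMap (ι₂.toLinearMap v) = v := fun v => pull_pull_eq_self_of_comp_eq_id (prodLift_snd _ _) v
  have hsum : ∀ v, ι₁.toLinearMap (π₁.toLinearMap v) + ι₂.toLinearMap (π₂.toLinearMap v) = v := fun v =>
    pull_pull_add_pull_pull_eq_self _ _ _ _ hsumP v
  -- the inner bicone `H¹(A × E') = fst^* H¹A ⊕ snd^* H¹E'`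
  let j₁ := BettiUniverse.pullHodgeHom exists_isReal_hodgeModel_holds hodgePQ_independent_of_hodgeModel_holds hP₁ hA
    (fst A C').hom.hom.hom 1
  let q₁ := BettiUniverse.pullHodgeHom exists_isReal_hodgeModel_holds hodgePQ_independent_of_hodgeModel_holds hA hP₁
    (prodLift (𝟙 A) (0 : A ⟶ C')).hom.hom.hom 1
  let j₂ := BettiUniverse.pullHodgeHom exists_isReal_hodgeModel_holds hodgePQ_independent_of_hodgeModel_holds hP₁ hC'
    (snd A C').hom.hom.hom 1
  let q₂ := BettiUniverse.pullHodgeHom exists_isReal_hodgeModel_holds hodgePQ_independent_of_hodgeModel_holds hC' hP₁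
    (prodLift (0 : C' ⟶ A) (𝟙 C')).hom.hom.hom 1
  have hsumP₁ : fst A C' ≫ prodLift (𝟙 A) (0 : A ⟶ C') + snd A C' ≫ prodLift (0 : C' ⟶ A) (𝟙 C') = 𝟙 _ := by
    refine prod_hom_ext ?_ ?_
    · rw [Preadditive.add_comp, Category.assoc, Category.assoc, prodLift_fst, prodLift_fst, Category.comp_id,
        comp_zero, add_zero, Category.id_comp]
    · rw [Preadditive.add_comp, Category.assoc, Category.assoc, prodLift_snd, prodLift_snd, Category.comp_id,
        comp_zero, zero_add, Category.id_comp]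
  have hqj₁ : ∀ v, q₁.toLinearMap (j₁.toLinearMap v) = v := fun v => pull_pull_eq_self_of_comp_eq_id (prodLift_fst _ _) v
  have hqj₂ : ∀ v, q₂.toLinearMap (j₂.toLinearMap v) = v := fun v => pull_pull_eq_self_of_comp_eq_id (prodLift_snd _ _) v
  have hsum₁ : ∀ v, j₁.toLinearMap (q₁.toLinearMap v) + j₂.toLinearMap (q₂.toLinearMap v) = v := fun v =>
    pull_pull_add_pull_pull_eq_self _ _ _ _ hsumP₁ v
  have hqjc₁ : q₁.toLinearMap ∘ₗ j₁.toLinearMap = LinearMap.id := LinearMap.ext hqj₁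
  have hqjc₂ : q₂.toLinearMap ∘ₗ j₂.toLinearMap = LinearMap.id := LinearMap.ext hqj₂
  have hq₁j₂ : q₁.toLinearMap ∘ₗ j₂.toLinearMap = 0 := by
    refine LinearMap.ext fun v => ?_
    have h := hsum₁ (j₂.toLinearMap v)
    rw [hqj₂, add_eq_right] at h
    have h' := congrArg q₁.toLinearMap h
    rw [hqj₁, map_zero] at h'
    exact h'
  have hq₂j₁ : q₂.toLinearMap ∘ₗ j₁.toLinearMap = 0 := by
    refine LinearMap.ext fun v => ?_
    have h := hsum₁ (j₁.toLinearMap v)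
    rw [hqj₁, add_eq_left] at h
    have h' := congrArg q₂.toLinearMap h
    rw [hqj₂, map_zero] at h'
    exact h'
  -- polarizations
  obtain ⟨ψP₁⟩ := BettiUniverse.hodge_isPolarizable exists_isReal_hodgeModel_holds hP₁ 1
  obtain ⟨ψ₁⟩ := BettiUniverse.hodge_isPolarizable exists_isReal_hodgeModel_holds hA 1
  obtain ⟨ψ₂⟩ := BettiUniverse.hodge_isPolarizable exists_isReal_hodgeModel_holds hC' 1
  obtain ⟨ψ₃⟩ := BettiUniverse.hodge_isPolarizable exists_isReal_hodgeModel_holds hC'' 1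
  -- the data on `A`, `E'`, `E''`
  set φQ : Module.End ℚ (bettiCohomology A.X 1) := (bettiCohomology.map φ.hom.hom.hom 1).hom with hφQ
  set χ'Q : Module.End ℚ (bettiCohomology C'.X 1) := (bettiCohomology.map χ'.hom.hom.hom 1).hom with hχ'Q
  set χ''Q : Module.End ℚ (bettiCohomology C''.X 1) := (bettiCohomology.map χ''.hom.hom.hom 1).hom with hχ''Q
  obtain ⟨hφE, -, hZ⟩ := quadraticEnd_skewCentre_data exists_isReal_hodgeModel_holds hodgePQ_independent_of_hodgeModel_holds hA0 hA2
    hd hφ ψ₁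
  have hχ'E : χ'Q ∈ (BettiUniverse.hodge exists_isReal_hodgeModel_holds hC' 1).endAlg :=
    pullback_mem_endAlg exists_isReal_hodgeModel_holds hodgePQ_independent_of_hodgeModel_holds χ'
  have hχ''E : χ''Q ∈ (BettiUniverse.hodge exists_isReal_hodgeModel_holds hC'' 1).endAlg :=
    pullback_mem_endAlg exists_isReal_hodgeModel_holds hodgePQ_independent_of_hodgeModel_holds χ''
  have hχ'2 : χ'Q * χ'Q = -((d' : ℚ) • 1) := bettiMapHom_mul_self hχ'
  have hχ''2 : χ''Q * χ''Q = -((d'' : ℚ) • 1) := bettiMapHom_mul_self hχ''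
  have hd'Q : (0 : ℚ) < d' := Nat.cast_pos.2 hd'
  have hd''Q : (0 : ℚ) < d'' := Nat.cast_pos.2 hd''
  have hV₂ : Module.finrank ℚ (bettiCohomology C'.X 1) = 2 := by rw [finrank_bettiCohomology_one C', hC'1]
  have hV₃ : Module.finrank ℚ (bettiCohomology C''.X 1) = 2 := by rw [finrank_bettiCohomology_one C'', hC''1]
  have heff₂ := BettiUniverse.hodge_isEffective exists_isReal_hodgeModel_holds hC' 1
  have heff₃ := BettiUniverse.hodge_isEffective exists_isReal_hodgeModel_holds hC'' 1
  -- `Lie Hg(H¹E') ⊆ ℚχ'^*`, `Lie Hg(H¹E'') ⊆ ℚχ''^*`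
  have hy' : (BettiUniverse.hodge exists_isReal_hodgeModel_holds hC' 1).hodgeLie ≤ ℚ ∙ χ'Q := by
    intro R hR
    obtain ⟨c, hc⟩ := RankTwoCM.exists_eq_ratCast_smul_of_commute_of_skew _ Nat.cast_one heff₂ hV₂ ψ₂ hχ'E hd'Q hχ'2
      (commute_of_mem_hodgeLie _ hR ⟨_, hχ'E⟩) (form_apply_add_eq_zero_of_mem_hodgeLie ψ₂ hR)
    exact Submodule.mem_span_singleton.2 ⟨c, hc.symm⟩
  have hy₀ : (BettiUniverse.hodge exists_isReal_hodgeModel_holds hC'' 1).hodgeLie ≤ ℚ ∙ χ''Q := by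
    intro R hR
    obtain ⟨c, hc⟩ := RankTwoCM.exists_eq_ratCast_smul_of_commute_of_skew _ Nat.cast_one heff₃ hV₃ ψ₃ hχ''E hd''Q hχ''2
      (commute_of_mem_hodgeLie _ hR ⟨_, hχ''E⟩) (form_apply_add_eq_zero_of_mem_hodgeLie ψ₃ hR)
    exact Submodule.mem_span_singleton.2 ⟨c, hc.symm⟩
  -- the centre of `Lie Hg(H¹A)` inside `End_Hdg(H¹A)` lies on `ℚφ^*`
  have hcenA : (BettiUniverse.hodge exists_isReal_hodgeModel_holds hA 1).hodgeLie ⊓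
      Subalgebra.toSubmodule (BettiUniverse.hodge exists_isReal_hodgeModel_holds hA 1).endAlg ≤ ℚ ∙ φQ := by
    intro a ha
    obtain ⟨ha𝔥, haE⟩ := Submodule.mem_inf.1 ha
    obtain ⟨x, hx⟩ := hZ a haE (fun b hb => commute_of_mem_hodgeLie _ ha𝔥 ⟨b, hb⟩)
      (form_apply_add_eq_zero_of_mem_hodgeLie ψ₁ ha𝔥)
    exact Submodule.mem_span_singleton.2 ⟨x, hx.symm⟩
  -- rigidity of `H¹(A × E')`
  have hrig₁ := hodgeLie_rigid_prod_cmCurve_of_rigid_of_quadraticEnd hA hP₁ hA0 hA2 φ hd hφ hrigA hC'1 χ' hd' hχ' hfree'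
  -- the central family `φ̃ = j₁ φ^* q₁`, `χ̃' = j₂ χ'^* q₂` of `H¹(A × E')`
  set e₀ : Module.End ℚ (bettiCohomology (A.prod C').X 1) := j₁.toLinearMap ∘ₗ φQ ∘ₗ q₁.toLinearMap with he₀
  set e₁ : Module.End ℚ (bettiCohomology (A.prod C').X 1) := j₂.toLinearMap ∘ₗ χ'Q ∘ₗ q₂.toLinearMap with he₁
  have he₀E : e₀ ∈ (BettiUniverse.hodge exists_isReal_hodgeModel_holds hP₁ 1).endAlg := comp_mem_endAlg_of_hom _ _ q₁ j₁ hφE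
  have he₁E : e₁ ∈ (BettiUniverse.hodge exists_isReal_hodgeModel_holds hP₁ 1).endAlg := comp_mem_endAlg_of_hom _ _ q₂ j₂ hχ'E
  have hφE' : ∀ i, (![e₀, e₁] : Fin 2 → _) i ∈ (BettiUniverse.hodge exists_isReal_hodgeModel_holds hP₁ 1).endAlg := by
    intro i
    fin_cases i
    · exact he₀E
    · exact he₁E
  -- the centre of `Lie Hg(H¹(A × E'))` inside `End_Hdg` lies in `ℚφ̃ ⊕ ℚχ̃'`
  have hcen : (BettiUniverse.hodge exists_isReal_hodgeModel_holds hP₁ 1).hodgeLie ⊓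
      Subalgebra.toSubmodule (BettiUniverse.hodge exists_isReal_hodgeModel_holds hP₁ 1).endAlg ≤
        Submodule.span ℚ (Set.range (![e₀, e₁] : Fin 2 → _)) := by
    intro z hz
    obtain ⟨hz𝔥, hzE⟩ := Submodule.mem_inf.1 hz
    rw [Subalgebra.mem_toSubmodule] at hzE
    have hz₁𝔥 := comp_mem_hodgeLie_of_retract j₁ q₁ hqj₁ hz𝔥
    have hz₁E := comp_mem_endAlg_of_hom _ _ j₁ q₁ hzE
    have hz₂𝔥 := comp_mem_hodgeLie_of_retract j₂ q₂ hqj₂ hz𝔥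
    obtain ⟨x, hx⟩ := Submodule.mem_span_singleton.1
      (hcenA (Submodule.mem_inf.2 ⟨hz₁𝔥, (Subalgebra.mem_toSubmodule _).2 hz₁E⟩))
    obtain ⟨y, hy⟩ := Submodule.mem_span_singleton.1 (hy' hz₂𝔥)
    have hsplit := eq_sum_blocks_of_mem_hodgeLie j₁ q₁ j₂ q₂ hqj₁ hqj₂ hsum₁ hz𝔥
    rw [← hx, ← hy] at hsplit
    simp only [LinearMap.smul_comp, LinearMap.comp_smul] at hsplit
    rw [hsplit]
    refine Submodule.add_mem _ (Submodule.smul_mem _ _ (Submodule.subset_span ⟨0, rfl⟩))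
      (Submodule.smul_mem _ _ (Submodule.subset_span ⟨1, rfl⟩))
  -- trace-orthogonality and the traces `tr(φ̃²) = tr((φ^*)²)`, `tr(χ̃'²) = tr((χ'^*)²)`
  have htr₀₁ : LinearMap.trace ℚ _ (e₀ * e₁) = 0 := by
    have h : e₀ * e₁ = 0 := by
      rw [he₀, he₁, Module.End.mul_eq_comp]
      refine LinearMap.ext fun v => ?_
      have h0 := LinearMap.congr_fun hq₁j₂ (χ'Q (q₂.toLinearMap v))
      simp only [LinearMap.comp_apply, LinearMap.zero_apply] at h0
      simp only [LinearMap.comp_apply, h0, map_zero, LinearMap.zero_apply]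
    rw [h, map_zero]
  have htr₁₀ : LinearMap.trace ℚ _ (e₁ * e₀) = 0 := by
    have h : e₁ * e₀ = 0 := by
      rw [he₀, he₁, Module.End.mul_eq_comp]
      refine LinearMap.ext fun v => ?_
      have h0 := LinearMap.congr_fun hq₂j₁ (φQ (q₁.toLinearMap v))
      simp only [LinearMap.comp_apply, LinearMap.zero_apply] at h0
      simp only [LinearMap.comp_apply, h0, map_zero, LinearMap.zero_apply]
    rw [h, map_zero]
  have htr₀₀ : LinearMap.trace ℚ _ (e₀ * e₀) = LinearMap.trace ℚ _ (φQ * φQ) := by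
    have h : e₀ * e₀ = j₁.toLinearMap ∘ₗ ((φQ * φQ) ∘ₗ q₁.toLinearMap) := by
      rw [he₀, Module.End.mul_eq_comp, Module.End.mul_eq_comp]
      refine LinearMap.ext fun v => ?_
      simp only [LinearMap.comp_apply, hqj₁]
    rw [h, LinearMap.trace_comp_comm', LinearMap.comp_assoc, hqjc₁, LinearMap.comp_id]
  have htr₁₁ : LinearMap.trace ℚ _ (e₁ * e₁) = LinearMap.trace ℚ _ (χ'Q * χ'Q) := by
    have h : e₁ * e₁ = j₂.toLinearMap ∘ₗ ((χ'Q * χ'Q) ∘ₗ q₂.toLinearMap) := by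
      rw [he₁, Module.End.mul_eq_comp, Module.End.mul_eq_comp]
      refine LinearMap.ext fun v => ?_
      simp only [LinearMap.comp_apply, hqj₂]
    rw [h, LinearMap.trace_comp_comm', LinearMap.comp_assoc, hqjc₂, LinearMap.comp_id]
  have htrφ : LinearMap.trace ℚ _ (φQ * φQ) = -((d : ℚ) * (2 * A.dim)) := trace_pullback_mul_self_eq φ hφ
  have htrχ' : LinearMap.trace ℚ _ (χ'Q * χ'Q) = -((d' : ℚ) * (2 * C'.dim)) := trace_pullback_mul_self_eq χ' hχ'
  have htrχ'' : LinearMap.trace ℚ _ (χ''Q * χ''Q) = -((d'' : ℚ) * (2 * C''.dim)) := trace_pullback_mul_self_eq χ'' hχ''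
  have horth : ∀ i j : Fin 2, i ≠ j → LinearMap.trace ℚ _ ((![e₀, e₁] : Fin 2 → _) i * (![e₀, e₁] : Fin 2 → _) j) = 0 := by
    intro i j hij
    fin_cases i <;> fin_cases j
    · exact absurd rfl hij
    · exact htr₀₁
    · exact htr₁₀
    · exact absurd rfl hij
  have htr : ∀ i : Fin 2, LinearMap.trace ℚ _ ((![e₀, e₁] : Fin 2 → _) i * (![e₀, e₁] : Fin 2 → _) i) ≠ 0 := by
    intro i
    fin_cases i
    · change LinearMap.trace ℚ _ (e₀ * e₀) ≠ 0
      rw [htr₀₀, htrφ]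
      have hdQ : (d : ℚ) ≠ 0 := by exact_mod_cast hd.ne'
      have hdim : ((A.dim : ℕ) : ℚ) ≠ 0 := by exact_mod_cast hA0.ne'
      exact neg_ne_zero.2 (mul_ne_zero hdQ (mul_ne_zero two_ne_zero hdim))
    · change LinearMap.trace ℚ _ (e₁ * e₁) ≠ 0
      rw [htr₁₁, htrχ', hC'1]
      have hdQ : (d' : ℚ) ≠ 0 := by exact_mod_cast hd'.ne'
      norm_num [hdQ]
  -- the trace test
  have hNR : ∀ Θ₁ : Module.End ℂ (ℂ ⊗[ℚ] bettiCohomology (A.prod C').X 1),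
      (∀ p, ∀ x ∈ (BettiUniverse.hodge exists_isReal_hodgeModel_holds hP₁ 1).piece p (((1 : ℕ) : ℤ) - p),
        Θ₁ x = ((2 * p - ((1 : ℕ) : ℤ) : ℤ) : ℂ) • x) →
      ∀ Θ₂ : Module.End ℂ (ℂ ⊗[ℚ] bettiCohomology C''.X 1),
      (∀ p, ∀ x ∈ (BettiUniverse.hodge exists_isReal_hodgeModel_holds hC'' 1).piece p (((1 : ℕ) : ℤ) - p),
        Θ₂ x = ((2 * p - ((1 : ℕ) : ℤ) : ℤ) : ℂ) • x) →
      ∀ ν : Fin 2 → ℚ, LinearMap.trace ℂ _ (Θ₂ * χ''Q.baseChange ℂ) ≠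
        ((LinearMap.trace ℚ _ (χ''Q * χ''Q) : ℚ) : ℂ) *
          ∑ i, (ν i : ℂ) * LinearMap.trace ℂ _ (Θ₁ * ((![e₀, e₁] : Fin 2 → _) i).baseChange ℂ) := by
    intro Θ₁ hΘ₁ Θ₂ hΘ₂ ν hμ
    -- the Hodge operators of `H¹A`, `H¹E'` compressed from `Θ₁`
    set ΘA := q₁.toLinearMap.baseChange ℂ ∘ₗ Θ₁ ∘ₗ j₁.toLinearMap.baseChange ℂ with hΘAdef
    set ΘC := q₂.toLinearMap.baseChange ℂ ∘ₗ Θ₁ ∘ₗ j₂.toLinearMap.baseChange ℂ with hΘCdef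
    have hΘA : ∀ p, ∀ x ∈ (BettiUniverse.hodge exists_isReal_hodgeModel_holds hA 1).piece p (((1 : ℕ) : ℤ) - p),
        ΘA x = ((2 * p - ((1 : ℕ) : ℤ) : ℤ) : ℂ) • x := by
      intro p x hx
      have hιx : j₁.toLinearMap.baseChange ℂ x ∈ (BettiUniverse.hodge exists_isReal_hodgeModel_holds hP₁ 1).piece p (((1 : ℕ) : ℤ) - p) :=
        j₁.map_piece_le p _ ⟨x, hx, rfl⟩
      rw [hΘAdef, LinearMap.comp_apply, LinearMap.comp_apply, hΘ₁ p _ hιx, map_smul, ← LinearMap.comp_apply,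
        ← LinearMap.baseChange_comp, hqjc₁, LinearMap.baseChange_id, LinearMap.id_apply]
    have hΘC : ∀ p, ∀ x ∈ (BettiUniverse.hodge exists_isReal_hodgeModel_holds hC' 1).piece p (((1 : ℕ) : ℤ) - p),
        ΘC x = ((2 * p - ((1 : ℕ) : ℤ) : ℤ) : ℂ) • x := by
      intro p x hx
      have hιx : j₂.toLinearMap.baseChange ℂ x ∈ (BettiUniverse.hodge exists_isReal_hodgeModel_holds hP₁ 1).piece p (((1 : ℕ) : ℤ) - p) :=
        j₂.map_piece_le p _ ⟨x, hx, rfl⟩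
      rw [hΘCdef, LinearMap.comp_apply, LinearMap.comp_apply, hΘ₁ p _ hιx, map_smul, ← LinearMap.comp_apply,
        ← LinearMap.baseChange_comp, hqjc₂, LinearMap.baseChange_id, LinearMap.id_apply]
    -- `tr(Θ₁ φ̃) = tr(Θ_A φ^*)`, `tr(Θ₁ χ̃') = tr(Θ_{E'} χ'^*)`
    have ht₀ : LinearMap.trace ℂ _ (Θ₁ * e₀.baseChange ℂ) = LinearMap.trace ℂ _ (ΘA * φQ.baseChange ℂ) := by
      rw [he₀, LinearMap.baseChange_comp, LinearMap.baseChange_comp, Module.End.mul_eq_comp, Module.End.mul_eq_comp,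
        ← LinearMap.comp_assoc, ← LinearMap.comp_assoc, LinearMap.trace_comp_comm', hΘAdef]
      simp only [LinearMap.comp_assoc]
    have ht₁ : LinearMap.trace ℂ _ (Θ₁ * e₁.baseChange ℂ) = LinearMap.trace ℂ _ (ΘC * χ'Q.baseChange ℂ) := by
      rw [he₁, LinearMap.baseChange_comp, LinearMap.baseChange_comp, Module.End.mul_eq_comp, Module.End.mul_eq_comp,
        ← LinearMap.comp_assoc, ← LinearMap.comp_assoc, LinearMap.trace_comp_comm', hΘCdef]
      simp only [LinearMap.comp_assoc]
    have htA := trace_theta_mul_baseChange_pullback_eq exists_isReal_hodgeModel_holds hodgePQ_independent_of_hodgeModel_holds φ hd hφ hΘA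
    have htC' := trace_theta_mul_baseChange_pullback_eq exists_isReal_hodgeModel_holds hodgePQ_independent_of_hodgeModel_holds χ' hd' hχ' hΘC
    have htC'' := trace_theta_mul_baseChange_pullback_eq exists_isReal_hodgeModel_holds hodgePQ_independent_of_hodgeModel_holds χ'' hd''
      hχ'' hΘ₂
    rw [← hφQ] at htA
    rw [← hχ'Q] at htC'
    rw [← hχ''Q] at htC''
    rw [Fin.sum_univ_two] at hμ
    simp only [Matrix.cons_val_zero, Matrix.cons_val_one] at hμ
    rw [ht₀, ht₁, htA, htC', htC'', htrχ'', hC''1] at hμ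
    -- multiplicities on the curves: `(1,0)` or `(0,1)`
    have hsum' := eigenMultiplicity_add_eigenMultiplicity_neg_eq_dim C' χ' hd' hχ'
    have hsum'' := eigenMultiplicity_add_eigenMultiplicity_neg_eq_dim C'' χ'' hd'' hχ''
    rw [hC'1] at hsum'
    rw [hC''1] at hsum''
    set ap := eigenMultiplicity A φ (Complex.I * (Real.sqrt d : ℂ)) with hap
    set am := eigenMultiplicity A φ (-(Complex.I * (Real.sqrt d : ℂ))) with ham
    set bp := eigenMultiplicity C' χ' (Complex.I * (Real.sqrt d' : ℂ)) with hbp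
    set bm := eigenMultiplicity C' χ' (-(Complex.I * (Real.sqrt d' : ℂ))) with hbm
    set cp := eigenMultiplicity C'' χ'' (Complex.I * (Real.sqrt d'' : ℂ)) with hcp
    set cm := eigenMultiplicity C'' χ'' (-(Complex.I * (Real.sqrt d'' : ℂ))) with hcm
    -- the rational relation `p√d'' + q√d + r√d' = 0`
    set p : ℚ := (cp : ℚ) - cm with hpdef
    set q : ℚ := 2 * d'' * ν 0 * ((ap : ℚ) - am) with hqdef
    set r : ℚ := 2 * d'' * ν 1 * ((bp : ℚ) - bm) with hrdef
    have hrel : (p : ℂ) * (Real.sqrt d'' : ℂ) + (q : ℂ) * (Real.sqrt d : ℂ) + (r : ℂ) * (Real.sqrt d' : ℂ) = 0 := by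
      have key : (2 * Complex.I) * ((p : ℂ) * (Real.sqrt d'' : ℂ) + (q : ℂ) * (Real.sqrt d : ℂ) + (r : ℂ) * (Real.sqrt d' : ℂ)) = 0 := by
        rw [hpdef, hqdef, hrdef]
        push_cast at hμ ⊢
        linear_combination hμ
      exact (mul_eq_zero.1 key).resolve_left (mul_ne_zero two_ne_zero Complex.I_ne_zero)
    obtain ⟨hp0, -, -⟩ := eq_zero_of_ratCast_mul_sqrt_add_add_eq_zero_complex hd hd'
      (forall_ne_sq_mul_symm hd'' hfree'') (forall_ne_sq_mul_symm hd'' hfree''') hfree' hrel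
    -- but `p = cp − cm = ±1`
    rw [hpdef, sub_eq_zero] at hp0
    have : cp = cm := by exact_mod_cast hp0
    omega
  -- conclude
  obtain ⟨-, hfin, hrig⟩ := corner_mem_and_finrank_eq_and_rigid_of_trace_ne_sum ι₁ π₁ ι₂ π₂ hπι₁ hπι₂ hsum hrig₁ hy₀ ψP₁ hφE'
    hcen horth htr hNR
  refine ⟨?_, hrig⟩
  have h1 : Module.finrank ℚ (BettiUniverse.hodge exists_isReal_hodgeModel_holds hC'' 1).hodgeLie = 1 := by
    obtain ⟨-, h2⟩ := isOfCMType_and_mtRank_eq_two_of_curve_of_comp_self_eq_neg hC'' hC''1 χ'' hd'' hχ''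
    rw [mtRank_hodge_one_eq_finrank_hodgeLie_add_one hC'' (by omega)] at h2
    omega
  rw [hfin, h1]

end Summit.HodgeConjecture.CorCM

end
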